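import Mathlib
import Summits.NavierStokesRegularity.NavierStokesRegularity.Theses.RootDecompLitSlice
import Summits.NavierStokesRegularity.NavierStokesRegularity.Theorems.RootDecompLitSliceGeneralWindowTradeoffClosed
import HarnessLib

/-!
# Route RootDecompLitSlice — THE CLOCK→SCAR TRANSFER LAW `α(b) = 4b/(b+2)` and support HV♯
  `FourFifthsVisibleScar` CLOSED (stmt-NavierStokesRegularity-27391)

With the free-window scar–modulus trade-off STg `GeneralWindowTradeoff` ⟨27390⟩ a kernel theorem
(`Theorems.generalWindowTradeoff`, `RootDecompLitSliceGeneralWindowTradeoffClosed.lean`), the writer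
g32 CLOCK→SCAR TRANSFER LAW (evidence file ScarExponentDial_g32.lean, sha256 a2b70d2daa73, kernel
`WriterG32.clockScarRung_of_generalWindow`) becomes unconditional:

* `ClockScarLaw.clockScarRung` (`0 < b ≤ 2`): on the classical Leray–Hopf frame (classical on
  `[0,T)`, Leray–Hopf on `[0,T]`, rapidly decaying datum), if the `L²`-trajectory reaches `u(T)` on
  the clock `∫|u(t) − u(T)|² ≤ K(T−t)^b` near `T`, then at every `x₀` the terminal local energy has a
  scar of order `α(b) = 4b/(b+2)`: `∫_{B_r(x₀)}|u(T)|² ≤ C r^{4b/(b+2)}` for small `r`. Proof: the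
  free-window trade-off with the SUPER-PARABOLIC window `τ = r^{4/(b+2)}` (`≤ r ≤ 1`) and the level
  `H = K'τ^b`, `K' = max K 1`; then `2H = 2K' r^{4b/(b+2)}` and
  `(r²/τ)√H = √K'·r^{2b/(b+2)}·r^{2b/(b+2)}` (verbatim port of the g32 kernel).
* `fourFifthsVisibleScar` — HV♯ ⟨27391⟩ BY NAME: the law at `b = 1/2`
  (`4·(1/2)/(1/2 + 2) = 4/5`): critically tame (`∫|u(t)−u(T)|² ≤ K√(T−t)`) ⟹ scar of order `4/5`.

HONEST FRAMING: HV♯ is route-internal SUPPORT (rank 9) — the BC5 rung of the Tao-vacuous cell Uᶜ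
`CritTameScarIsCritical` ⟨31733⟩ (scar order `4/5 < 1` = Uᶜ's conclusion; strictly weaker than Uᶜ by
scaling; critic row 563); it moves no load of the route (ROOT ⟺ U ∧ P1, rows 354/371). The open
layer of Uᶜ is the window `b ∈ [1/2, 2/3)`, `α ∈ [4/5, 1)`. Rung 0: nothing here proves NS
regularity. Decomp-ns route-writer g36. [folklore]
-/

set_option linter.dupNamespace false

namespace Summit.NavierStokesRegularity.NavierStokesRegularity.Theorems

open MeasureTheory Set
open scoped ENNReal

namespace ClockScarLaw

/-- ★ **The clock→scar transfer law `α(b) = 4b/(b+2)`** (`0 < b ≤ 2`) on the classical Leray–Hopf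
frame: clock `∫|u(t)−u(T)|² ≤ K(T−t)^b` near `T` ⟹ `∫_{B_r(x₀)}|u(T)|² ≤ C r^{4b/(b+2)}` for small
`r`, at every `x₀`. The free-window trade-off `generalWindowTradeoff` with `τ = r^{4/(b+2)}`,
`H = max K 1 · τ^b`. [folklore] -/
theorem clockScarRung {b : ℝ} (hb : 0 < b) (hb2 : b ≤ 2) :
    ∀ (ν T : ℝ), 0 < ν → 0 < T →
    ∀ (u : ℝ → EuclideanSpace ℝ (Fin 3) → EuclideanSpace ℝ (Fin 3))
      (p : ℝ → EuclideanSpace ℝ (Fin 3) → ℝ),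
      Literature.Analysis.FluidPDE.IsClassicalNSSolutionOn (Set.Ico 0 T) ν 0 u p →
      Literature.Analysis.FluidPDE.IsLerayHopfOn T ν 0 (u 0) u →
      Literature.Analysis.FluidPDE.HasRapidSpatialDecay (u 0) →
      (∃ K T₁ : ℝ, T₁ < T ∧ ∀ t ∈ Set.Ioo T₁ T,
        ∫⁻ x, ‖u t x - u T x‖ₑ ^ 2 ≤ ENNReal.ofReal (K * (T - t) ^ b)) →
      ∀ x₀ : EuclideanSpace ℝ (Fin 3), ∃ C r₁ : ℝ, 0 < r₁ ∧ ∀ r ∈ Set.Ioo 0 r₁,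
        ∫ x in Metric.ball x₀ r, ‖u T x‖ ^ 2 ≤ C * r ^ (4 * b / (b + 2)) := by
  intro ν T hν hT u p hcl hLH hdec hclock x₀
  obtain ⟨K, T₁, hT₁, hK⟩ := hclock
  obtain ⟨K', hK'def⟩ : ∃ K' : ℝ, K' = max K 1 := ⟨_, rfl⟩
  have hK'pos : 0 < K' := by rw [hK'def]; exact lt_of_lt_of_le one_pos (le_max_right _ _)
  have hKK' : K ≤ K' := by rw [hK'def]; exact le_max_left _ _
  have hb2pos : 0 < b + 2 := by linarith
  obtain ⟨e, hedef⟩ : ∃ e : ℝ, e = 4 / (b + 2) := ⟨_, rfl⟩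
  have he1 : 1 ≤ e := by
    rw [hedef, le_div_iff₀ hb2pos]; linarith
  obtain ⟨δ, hδdef⟩ : ∃ δ : ℝ, δ = min 1 (min (T - T₁) T) := ⟨_, rfl⟩
  have hδpos : 0 < δ := by
    rw [hδdef]; exact lt_min one_pos (lt_min (sub_pos.mpr hT₁) hT)
  refine ⟨2 * K' + 8 * Real.sqrt (∫ x, ‖u 0 x‖ ^ 2) / ν * Real.sqrt K', δ, hδpos, ?_⟩
  intro r hr
  have hr0 : 0 < r := hr.1
  have hrδ : r < δ := hr.2
  have hr1 : r ≤ 1 := hrδ.le.trans (by rw [hδdef]; exact min_le_left _ _)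
  have hrT₁ : r < T - T₁ :=
    lt_of_lt_of_le hrδ (by rw [hδdef]; exact (min_le_right _ _).trans (min_le_left _ _))
  have hrT : r < T :=
    lt_of_lt_of_le hrδ (by rw [hδdef]; exact (min_le_right _ _).trans (min_le_right _ _))
  -- the window
  obtain ⟨τ, hτdef⟩ : ∃ τ : ℝ, τ = r ^ e := ⟨_, rfl⟩
  have hτpos : 0 < τ := by rw [hτdef]; exact Real.rpow_pos_of_pos hr0 e
  have hτler : τ ≤ r := by
    have h1 := Real.rpow_le_rpow_of_exponent_ge hr0 hr1 he1
    rw [Real.rpow_one] at h1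
    rw [hτdef]; exact h1
  have hτT : τ < T := lt_of_le_of_lt hτler hrT
  have hτT₁ : τ < T - T₁ := lt_of_le_of_lt hτler hrT₁
  -- the modulus level
  obtain ⟨H, hHdef⟩ : ∃ H : ℝ, H = K' * τ ^ b := ⟨_, rfl⟩
  have hτb : 0 ≤ τ ^ b := Real.rpow_nonneg hτpos.le b
  have hH : 0 ≤ H := by rw [hHdef]; exact mul_nonneg hK'pos.le hτb
  have hmod : ∀ t ∈ Set.Ico (T - τ) T,
      ∫⁻ x, ‖u t x - u T x‖ₑ ^ 2 ≤ ENNReal.ofReal H := by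
    intro t ht
    have ht1 : T₁ < t := by linarith [ht.1]
    refine (hK t ⟨ht1, ht.2⟩).trans (ENNReal.ofReal_le_ofReal ?_)
    have h0 : 0 ≤ T - t := by linarith [ht.2]
    have h1 : T - t ≤ τ := by linarith [ht.1]
    have hpow : (T - t) ^ b ≤ τ ^ b := Real.rpow_le_rpow h0 h1 hb.le
    rw [hHdef]
    calc K * (T - t) ^ b ≤ K' * (T - t) ^ b :=
          mul_le_mul_of_nonneg_right hKK' (Real.rpow_nonneg h0 b)
      _ ≤ K' * τ ^ b := mul_le_mul_of_nonneg_left hpow hK'pos.le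
  have hmain := generalWindowTradeoff ν T hν hT u p hcl hLH hdec x₀ r τ H hr0 hτpos hτT hH hmod
  -- exponent bookkeeping
  have hexp1 : τ ^ b = r ^ (4 * b / (b + 2)) := by
    rw [hτdef, ← Real.rpow_mul hr0.le]
    congr 1
    rw [hedef]; field_simp
  have hexp2 : Real.sqrt (r ^ (4 * b / (b + 2))) = r ^ (2 * b / (b + 2)) := by
    rw [Real.sqrt_eq_rpow, ← Real.rpow_mul hr0.le]
    congr 1
    field_simp; ring
  have hexp3 : r ^ 2 / τ = r ^ (2 * b / (b + 2)) := by
    rw [hτdef, ← Real.rpow_two, ← Real.rpow_sub hr0]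
    congr 1
    rw [hedef]; field_simp; ring
  have hexp4 : r ^ (2 * b / (b + 2)) * r ^ (2 * b / (b + 2)) = r ^ (4 * b / (b + 2)) := by
    rw [← Real.rpow_add hr0]
    congr 1; ring
  have hsqrtH : Real.sqrt H = Real.sqrt K' * r ^ (2 * b / (b + 2)) := by
    rw [hHdef, Real.sqrt_mul hK'pos.le, hexp1, hexp2]
  refine hmain.trans (le_of_eq ?_)
  rw [hsqrtH, hexp3, hHdef, hexp1]
  generalize Real.sqrt (∫ x, ‖u 0 x‖ ^ 2) = S
  generalize hX : r ^ (4 * b / (b + 2)) = X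
  generalize hY : r ^ (2 * b / (b + 2)) = Y
  rw [hX, hY] at hexp4
  calc 2 * (K' * X) + 8 * S / ν * Y * (Real.sqrt K' * Y)
      = 2 * (K' * X) + 8 * S / ν * Real.sqrt K' * (Y * Y) := by ring
    _ = (2 * K' + 8 * S / ν * Real.sqrt K') * X := by rw [hexp4]; ring

end ClockScarLaw

/-- **Support HV♯ `FourFifthsVisibleScar` of route RootDecompLitSlice, by name** («four-fifths
visibility of critically tame scars»): the clock→scar law `ClockScarLaw.clockScarRung` at `b = 1/2`,
`α = 4·(1/2)/(1/2+2) = 4/5`. Route-internal support (the BC5 rung of Uᶜ); decorative for the summit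
(D-0179). [folklore] -/
theorem fourFifthsVisibleScar :
    Summit.NavierStokesRegularity.NavierStokesRegularity.Theses.RootDecompLitSlice.FourFifthsVisibleScar := by
  intro ν T hν hT u p hcl hLH hdec hclock x₀
  obtain ⟨K, T₁, hT₁, hK⟩ := hclock
  have hclock' : ∃ K T₁ : ℝ, T₁ < T ∧ ∀ t ∈ Set.Ioo T₁ T,
      ∫⁻ x, ‖u t x - u T x‖ₑ ^ 2 ≤ ENNReal.ofReal (K * (T - t) ^ (1 / 2 : ℝ)) :=
    ⟨K, T₁, hT₁, fun t ht => by rw [← Real.sqrt_eq_rpow]; exact hK t ht⟩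
  obtain ⟨C, r₁, hr₁, hC⟩ :=
    ClockScarLaw.clockScarRung (b := 1 / 2) (by norm_num) (by norm_num)
      ν T hν hT u p hcl hLH hdec hclock' x₀
  refine ⟨C, r₁, hr₁, fun r hr => ?_⟩
  have h1 := hC r hr
  rw [show (4 * (1 / 2 : ℝ) / (1 / 2 + 2)) = 4 / 5 by norm_num] at h1
  exact h1

end Summit.NavierStokesRegularity.NavierStokesRegularity.Theorems
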